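import Literature.Probability.RandomPlanarGeometry.SLERSObservableIto
import Literature.Probability.RandomPlanarGeometry.CritPercSLESwallowingProofs
import Literature.Probability.RandomPlanarGeometry.SLECriticalGhat
import Literature.Probability.Process.ContinuousHitting
import HarnessLib

/-!
# The lower tail of Rohde–Schramm's derivative ratio: `P[sup_{t<τ(z)} ψₜ(z) ≥ λ] ≥ Ĝ(z) λ^{-(1-κ/8)}`

Topic `Probability/RandomPlanarGeometry`. For `0 < κ < 8`, `z = x + iy ∈ ℍ` and `λ ≥ 1`,

  `P[ ∃ t < τ(z), ψₜ(z) ≥ λ ] ≥ Ĝ_{1-κ/8,κ}(z) λ^{-(1-κ/8)}`,   `Ĝ_{1-κ/8,κ}(z) = (y/|z|)^{(8-κ)/κ}`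

(`rsGhatSlope_le_rpow_mul_measureReal`), where `ψₜ(z) = (Im z)|gₜ'(z)|/Im gₜ(z)` is Rohde–Schramm's
ratio (Ann. of Math. 161 (2005), Lemma 6.3) — the **lower** half of the one-point estimate for the
SLE_κ trace (Beffara, Ann. Probab. 36 (2008), Prop. 4: `P(B(z, ε) ∩ γ ≠ ∅) ≍ (ε/Im z)^{1-κ/8}
(sin arg z)^{8/κ-1}`; Lawler (2005), Thm. 7.9, lower half), read on `Z(z) = sup ψ` before the
passage to `dist(z, γ)` by (6.2) (file `SLEOnePointLowerBound`).

Proof — optional stopping for the **critical** Rohde–Schramm martingale. At `a₀ = 1 - κ/8` the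
observable `Mₜ = ψₜ^{a₀} Ĝ_{a₀,κ}(zₜ)` of the tree's Itô step
(`martingale_stoppedProcess_sleRSObservable_of_le_locTime`, any stopping time `σ ≤ ρₙ` along which
the slope `wₜ = xₜ/yₜ` is bounded) has `Ĝ_{a₀,κ}(w + i) = (1+w²)^{-β₀} ∈ (0, 1]`
(`rsGhatSlope_critical`, `SLECriticalGhat.lean`). Stop at `S = H_λ ∧ T_s ∧ ρₙ`, where `H_λ` is the
hitting time of `ψ^{ρₙ} ≥ λ` (`slePsiHitTime`, a stopping time by
`Literature.Probability.Process.isStoppingTime_hittingAfter_of_continuous`) and `T_s ∧ ρₙ` is the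
tree's `sleCotArgLocTime` (exit of `|w|` from `[0, s)`): then `E[M_S] = M₀ = Ĝ(z)` and pathwise
`M_S ≤ λ^{a₀} Ĝ(w_S + i) ≤ λ^{a₀}(𝟙_E + Ĝ(s + i) + 𝟙_{Dₙ})`, according as `ψ` reaches `λ` before
`τ(z)` (the event `E`), or not and `|w|` reaches `s` first, or not and `ρₙ` rings first (the event
`Dₙ = {ψ_{ρₙ} ≤ λ, |w| ≤ s on [0, ρₙ]}`, which decreases to `∅` by the tree's
`Loewner.tendsto_derivRatio_atTop_of_abs_cotArg_le`: "`|w| ≤ s` on `[0, τ)` forces `ψ → ∞`").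
Letting `n → ∞` and then `s → ∞` (`Ĝ(s + i) → 0`) gives `Ĝ(z) ≤ λ^{a₀} P(E)`. This is the standard
Green's-function lower bound (the martingale `|gₜ'|^{2-d} G(gₜ(z) - Wₜ)`), replacing the exact
hypergeometric computations of the printed sources; cf. Rohde–Schramm's use of the same stopping
times for `κ ≥ 8` (tree: `measureReal_forall_sleDerivRatio_le_le`).

## References

* S. Rohde, O. Schramm, *Basic properties of SLE*, Ann. of Math. 161 (2005), Lemma 6.3 and its
  proof (pp. 903–906).
* V. Beffara, *The dimension of the SLE curves*, Ann. Probab. 36 (2008), Prop. 4.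
* G. F. Lawler, *Conformally Invariant Processes in the Plane*, AMS (2005), §7.4, Thm. 7.9.
-/

noncomputable section

open Set Filter MeasureTheory Complex
open _root_.Topology
open scoped NNReal ENNReal

namespace Literature.Probability.RandomPlanarGeometry

open Loewner Literature.Probability.Process

variable (κ : ℝ≥0) (z : ℂ)

/-! ### The hitting time of `ψ ≥ λ` and the combined stopping time -/

/-- The gauge `ψ^{ρₙ}_t - λ` (continuous, adapted) whose entrance time in `[0, ∞)` is the hitting
time of the level `λ` by Rohde–Schramm's ratio along `[0, ρₙ]`. [folklore] -/
def slePsiGauge (lam : ℝ) (n : ℕ) (t : ℝ≥0) (ω : ℝ≥0 → ℝ) : ℝ :=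
  stoppedProcess (slePointPsi κ z) (slePointLocTime κ z n) t ω - lam

/-- **`H_λ`**: the hitting time of `{ψ^{ρₙ} ≥ λ}` (valued in `WithTop ℝ≥0`; `⊤` if `ψ < λ` on
`[0, ρₙ]`). [folklore] -/
def slePsiHitTime (lam : ℝ) (n : ℕ) (ω : ℝ≥0 → ℝ) : WithTop ℝ≥0 :=
  hittingAfter (slePsiGauge κ z lam n) (Ici 0) 0 ω

/-- **`S = H_λ ∧ T_s ∧ ρₙ`**: the critical martingale is read at this stopping time. [folklore] -/
def sleTailTime (s lam : ℝ) (n : ℕ) (ω : ℝ≥0 → ℝ) : WithTop ℝ≥0 :=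
  min (slePsiHitTime κ z lam n ω) (sleCotArgLocTime κ z s n ω)

variable {κ z} {n : ℕ} {s lam : ℝ}

section Pathwise

/-- The gauge has continuous paths. [folklore] -/
theorem continuous_slePsiGauge (hz : 0 < z.im) (lam : ℝ) (n : ℕ) (ω : ℝ≥0 → ℝ) :
    Continuous fun t ↦ slePsiGauge κ z lam n t ω :=
  (continuous_stoppedProcess_slePointPsi hz (σ := slePointLocTime κ z n) (fun _ ↦ le_rfl) ω).sub
    continuous_const

/-- The gauge is adapted. [folklore] -/
theorem adapted_slePsiGauge (hz : 0 < z.im) (lam : ℝ) (n : ℕ) :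
    Adapted brownianFiltration (slePsiGauge κ z lam n) := fun t ↦
  ((stronglyAdapted_stoppedProcess_slePointPsi hz (isStoppingTime_slePointLocTime κ hz n)
    (fun _ ↦ le_rfl) t).measurable).sub_const lam

/-- `H_λ` is a stopping time of the raw Brownian filtration. [folklore] -/
theorem isStoppingTime_slePsiHitTime (hz : 0 < z.im) (lam : ℝ) (n : ℕ) :
    IsStoppingTime brownianFiltration (slePsiHitTime κ z lam n) :=
  isStoppingTime_hittingAfter_of_continuous (adapted_slePsiGauge hz lam n)
    (continuous_slePsiGauge hz lam n) isClosed_Ici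

/-- `S` is a stopping time of the raw Brownian filtration. [folklore] -/
theorem isStoppingTime_sleTailTime (hz : 0 < z.im) (s lam : ℝ) (n : ℕ) :
    IsStoppingTime brownianFiltration (sleTailTime κ z s lam n) :=
  (isStoppingTime_slePsiHitTime hz lam n).min (isStoppingTime_sleCotArgLocTime hz s n)

/-- `S ≤ T_s ∧ ρₙ`. [folklore] -/
theorem sleTailTime_le_cotArgLocTime (ω : ℝ≥0 → ℝ) :
    sleTailTime κ z s lam n ω ≤ sleCotArgLocTime κ z s n ω := min_le_right _ _

/-- `S ≤ H_λ`. [folklore] -/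
theorem sleTailTime_le_psiHitTime (ω : ℝ≥0 → ℝ) :
    sleTailTime κ z s lam n ω ≤ slePsiHitTime κ z lam n ω := min_le_left _ _

/-- `S ≤ ρₙ`. [folklore] -/
theorem sleTailTime_le_locTime (ω : ℝ≥0 → ℝ) :
    sleTailTime κ z s lam n ω ≤ slePointLocTime κ z n ω :=
  (sleTailTime_le_cotArgLocTime ω).trans (sleCotArgLocTime_le_locTime s n ω)

/-- `S` is finite (`≤ ρₙ ≤ n + 1`). [folklore] -/
theorem sleTailTime_ne_top (ω : ℝ≥0 → ℝ) : sleTailTime κ z s lam n ω ≠ ⊤ :=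
  ne_top_of_le_ne_top (slePointLocTime_ne_top n ω) (sleTailTime_le_locTime ω)

/-- On `[0, S]` the slope is bounded by `s`, provided `|w₀| < s`. [folklore] -/
theorem abs_cotArg_le_of_le_sleTailTime (hz : 0 < z.im) (h0 : |z.re / z.im| < s) {ω : ℝ≥0 → ℝ}
    {t : ℝ≥0} (ht : (t : WithTop ℝ≥0) ≤ sleTailTime κ z s lam n ω) :
    |cotArg (sleDriving κ ω) z t| ≤ s :=
  abs_cotArg_le_of_le_sleCotArgLocTime hz h0 (ht.trans (sleTailTime_le_cotArgLocTime ω))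

/-- Before `H_λ`: `ψ_{t ∧ ρₙ} < λ`. [folklore] -/
theorem stoppedProcess_slePointPsi_lt_of_lt_psiHitTime {ω : ℝ≥0 → ℝ} {t : ℝ≥0}
    (ht : (t : WithTop ℝ≥0) < slePsiHitTime κ z lam n ω) :
    stoppedProcess (slePointPsi κ z) (slePointLocTime κ z n) t ω < lam := by
  have h := notMem_of_coe_lt_hittingAfter_zero (u := slePsiGauge κ z lam n) (s := Ici 0) ht
  simp only [mem_Ici, not_le, slePsiGauge] at h
  linarith

/-- If `ψ < λ` along `[0, ρₙ]` (at all clock values), then `H_λ = ⊤`. [folklore] -/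
theorem slePsiHitTime_eq_top {ω : ℝ≥0 → ℝ}
    (h : ∀ t : ℝ≥0, stoppedProcess (slePointPsi κ z) (slePointLocTime κ z n) t ω < lam) :
    slePsiHitTime κ z lam n ω = ⊤ :=
  hittingAfter_zero_apply_of_forall fun t ↦ by
    simp only [mem_Ici, not_le, slePsiGauge]
    linarith [h t]

/-- **`ψ_S ≤ λ`** (`λ ≥ 1`): `ψ < λ` strictly before `S ≤ H_λ`, `ψ^{ρₙ}` is continuous, and
`ψ₀ = 1`. [folklore] -/
theorem derivRatio_le_of_sleTailTime_eq (hz : 0 < z.im) (hlam : 1 ≤ lam) {ω : ℝ≥0 → ℝ} {u : ℝ≥0}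
    (hu : sleTailTime κ z s lam n ω = u) : derivRatio (sleDriving κ ω) z u ≤ lam := by
  set P : ℝ≥0 → ℝ := fun t ↦ stoppedProcess (slePointPsi κ z) (slePointLocTime κ z n) t ω with hP
  have hcont : Continuous P := continuous_stoppedProcess_slePointPsi hz (fun _ ↦ le_rfl) ω
  have huρ : ((u : ℝ≥0) : WithTop ℝ≥0) ≤ slePointLocTime κ z n ω := hu ▸ sleTailTime_le_locTime ω
  have hPu : P u = derivRatio (sleDriving κ ω) z u := by
    simp only [hP, stoppedProcess_slePointPsi_eq, min_eq_left huρ]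
    rfl
  rw [← hPu]
  rcases eq_or_ne u 0 with rfl | hu0
  · simp only [hP, stoppedProcess_slePointPsi_zero hz]
    exact hlam
  · have hlt : ∀ t : ℝ≥0, t < u → P t < lam := fun t ht ↦
      stoppedProcess_slePointPsi_lt_of_lt_psiHitTime
        ((WithTop.coe_lt_coe.2 ht).trans_le (hu ▸ sleTailTime_le_psiHitTime ω))
    have hmaps : MapsTo P (Iio u) (Iic lam) := fun t ht ↦ (hlt t ht).le
    have hcl : u ∈ closure (Iio u) := by
      rw [closure_Iio' (show (Iio u).Nonempty from ⟨0, pos_iff_ne_zero.2 hu0⟩)]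
      exact self_mem_Iic
    have h := map_mem_closure hcont hcl hmaps
    rwa [isClosed_Iic.closure_eq] at h

end Pathwise

/-! ### The events `E_λ` (the ratio reaches `λ`) and `Dₙ` (neither `λ` nor `s` reached by `ρₙ`) -/

variable (κ z) in
/-- **`E_λ = {∃ t < τ(z), ψₜ(z) ≥ λ}`**: Rohde–Schramm's ratio reaches the level `λ` before the
swallowing time (equivalently `Z(z) = sup_{t<τ} ψₜ ≥ λ`, the ratio being continuous and
non-decreasing). [cite: RohdeSchramm2005, Lemma 6.3] -/
def sleRatioReach (lam : ℝ) : Set (ℝ≥0 → ℝ) :=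
  {ω | ∃ t : ℝ≥0, (t : WithTop ℝ≥0) < swallowingTime (sleDriving κ ω) z ∧
    lam ≤ derivRatio (sleDriving κ ω) z t}

variable (κ z) in
/-- The slope `w_{t ∧ ρₙ} = x^{ρₙ}_t / y^{ρₙ}_t` read on the stopped flow (`stopped_div_eq_cotArg`).
[folklore] -/
def sleStoppedSlope (n : ℕ) (t : ℝ≥0) (ω : ℝ≥0 → ℝ) : ℝ :=
  stoppedProcess (slePointRe κ z) (slePointLocTime κ z n) t ω /
    stoppedProcess (slePointIm κ z) (slePointLocTime κ z n) t ω

variable (κ z) in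
/-- **`Dₙ = {ψ_{ρₙ} ≤ λ and |w| ≤ s on [0, ρₙ]}`**: the event on which the localizing time `ρₙ`
rings before the ratio reaches `λ` and before the slope reaches `s` (it decreases to `∅` as
`n → ∞`, `iInter_sleTailBad_eq_empty`). [folklore] -/
def sleTailBad (s lam : ℝ) (n : ℕ) : Set (ℝ≥0 → ℝ) :=
  {ω | stoppedProcess (slePointPsi κ z) (slePointLocTime κ z n) ((n : ℝ≥0) + 1) ω ≤ lam ∧
    ∀ t : ℝ≥0, |sleStoppedSlope κ z n t ω| ≤ s}

/-- `sleStoppedSlope κ z n t ω = w` at the clock `t ∧ ρₙ`. [folklore] -/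
theorem sleStoppedSlope_eq_cotArg (hz : 0 < z.im) (n : ℕ) (t : ℝ≥0) (ω : ℝ≥0 → ℝ) :
    sleStoppedSlope κ z n t ω =
      cotArg (sleDriving κ ω) z ((min (t : WithTop ℝ≥0) (slePointLocTime κ z n ω)).untopA) :=
  stopped_div_eq_cotArg hz (σ := slePointLocTime κ z n) (fun _ ↦ le_rfl) t ω

/-- `ψ^{ρₙ}` at time `n + 1` is `ψ_{ρₙ}`. [folklore] -/
theorem stoppedProcess_slePointPsi_succ (n : ℕ) (ω : ℝ≥0 → ℝ) :
    stoppedProcess (slePointPsi κ z) (slePointLocTime κ z n) ((n : ℝ≥0) + 1) ω =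
      derivRatio (sleDriving κ ω) z (slePointLocTime κ z n ω).untopA := by
  rw [stoppedProcess_slePointPsi_eq, min_eq_right (slePointLocTime_le n ω)]

/-! ### The critical martingale stopped at `S` -/

section Martingale

/-- **The critical observable stopped at `S` is a martingale** (`a₀ = 1 - κ/8`, discriminant `64`;
the tree's Itô step `martingale_stoppedProcess_sleRSObservable_of_le_locTime` with `σ = S ≤ ρₙ`,
`|w| ≤ s` on `[0, S]`). [cite: RohdeSchramm2005, Lemma 6.3 (proof)] -/
theorem martingale_stoppedProcess_critical (hκ : 0 < κ) (hz : 0 < z.im) (h0 : |z.re / z.im| < s)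
    (lam : ℝ) (n : ℕ) :
    Martingale (stoppedProcess (sleRSObservable κ (1 - (κ : ℝ) / 8) z) (sleTailTime κ z s lam n))
      brownianFiltration preWienerMeasure :=
  martingale_stoppedProcess_sleRSObservable_of_le_locTime hκ (by rw [discr_oneSub]; norm_num) hz
    (isStoppingTime_sleTailTime hz s lam n) sleTailTime_le_locTime
    (fun _ _ ht ↦ abs_cotArg_le_of_le_sleTailTime hz h0 ht)

/-- The stopped critical observable at time `0` is `Ĝ(z) = Ĝ_{a₀,κ}(x/y + i)`. [cite: RohdeSchramm2005, Lemma 6.3 (proof)] -/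
theorem stoppedProcess_critical_zero (hz : 0 < z.im) (ω : ℝ≥0 → ℝ) :
    stoppedProcess (sleRSObservable κ (1 - (κ : ℝ) / 8) z) (sleTailTime κ z s lam n) 0 ω =
      rsGhatSlope (1 - (κ : ℝ) / 8) κ (z.re / z.im) := by
  rw [stoppedProcess_eq_of_le (by exact bot_le), sleRSObservable,
    Loewner.rsObservable_zero (continuous_sleDriving κ ω) hz, sleDriving_zero, Complex.ofReal_zero,
    sub_zero, rsGhat_eq_rsGhatSlope _ _ hz.ne']

/-- **`E[M_{t ∧ S}] = Ĝ(z)`** for every `t` (martingale identity, `M₀ = Ĝ(z)`).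
[cite: RohdeSchramm2005, Lemma 6.3 (proof)] -/
theorem integral_stoppedProcess_critical (hκ : 0 < κ) (hz : 0 < z.im) (h0 : |z.re / z.im| < s)
    (lam : ℝ) (n : ℕ) (t : ℝ≥0) :
    ∫ ω, stoppedProcess (sleRSObservable κ (1 - (κ : ℝ) / 8) z) (sleTailTime κ z s lam n) t ω
        ∂preWienerMeasure = rsGhatSlope (1 - (κ : ℝ) / 8) κ (z.re / z.im) := by
  haveI := isProbabilityMeasure_preWienerMeasure'
  have hmart := martingale_stoppedProcess_critical hκ hz h0 lam n
  have h1 := hmart.setIntegral_eq (zero_le : (0 : ℝ≥0) ≤ t) (s := univ) MeasurableSet.univ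
  rw [setIntegral_univ, setIntegral_univ] at h1
  rw [← h1]
  simp_rw [stoppedProcess_critical_zero hz]
  rw [integral_const, smul_eq_mul, probReal_univ, one_mul]

/-- **The stopped observable at time `n + 1` is `M_S = ψ_S^{a₀} Ĝ(w_S + i)`** (`S ≤ ρₙ ≤ n + 1`,
`S < τ(z)`). [cite: RohdeSchramm2005, Lemma 6.3 (proof)] -/
theorem stoppedProcess_critical_succ_eq (hz : 0 < z.im) {ω : ℝ≥0 → ℝ} {u : ℝ≥0}
    (hu : sleTailTime κ z s lam n ω = u) :
    stoppedProcess (sleRSObservable κ (1 - (κ : ℝ) / 8) z) (sleTailTime κ z s lam n) ((n : ℝ≥0) + 1) ω =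
      derivRatio (sleDriving κ ω) z u ^ (1 - (κ : ℝ) / 8) *
        rsGhatSlope (1 - (κ : ℝ) / 8) κ (cotArg (sleDriving κ ω) z u) := by
  have hW := continuous_sleDriving κ ω
  have hle : sleTailTime κ z s lam n ω ≤ (((n : ℝ≥0) + 1 : ℝ≥0) : WithTop ℝ≥0) :=
    (sleTailTime_le_locTime ω).trans (slePointLocTime_le n ω)
  have huρ : ((u : ℝ≥0) : WithTop ℝ≥0) ≤ slePointLocTime κ z n ω := hu ▸ sleTailTime_le_locTime ω
  have hlt : ((u : ℝ≥0) : WithTop ℝ≥0) < swallowingTime (sleDriving κ ω) z :=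
    coe_lt_swallowingTime_of_le_locTime hz huρ
  have hy : (centredMap (sleDriving κ ω) u z).im ≠ 0 := (im_centredMap_pos hW hz hlt).ne'
  rw [stoppedProcess_eq_of_ge hle, hu]
  change sleRSObservable κ (1 - (κ : ℝ) / 8) z u ω = _
  rw [sleRSObservable, Loewner.rsObservable_of_lt hlt, rsGhat_eq_rsGhatSlope _ _ hy, ← cotArg_apply]

/-- **Pathwise bound at `S`**: with `|w₀| < s`, `λ ≥ 1`, `0 < κ ≤ 8`,
`M_S ≤ λ^{a₀} (𝟙_{Ē}(ω) + Ĝ(s + i) + 𝟙_{Dₙ}(ω))` for any set `Ē ⊇ E_λ`: `ψ_S ≤ λ` always; if `ψ`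
reaches `λ` before `τ(z)` use `Ĝ ≤ 1`; otherwise `H_λ = ∞` and `S = T_s ∧ ρₙ`, and either `|w_S| = s`
(so `Ĝ(w_S + i) = Ĝ(s + i)`) or `S = ρₙ` and `ω ∈ Dₙ`. [cite: RohdeSchramm2005, Lemma 6.3 (proof)] -/
theorem stoppedProcess_critical_succ_le (hκ0 : 0 < κ) (hκ8 : κ ≤ 8) (hz : 0 < z.im)
    (h0 : |z.re / z.im| < s) (hlam : 1 ≤ lam) {Ebar : Set (ℝ≥0 → ℝ)} (hE : sleRatioReach κ z lam ⊆ Ebar)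
    (ω : ℝ≥0 → ℝ) :
    stoppedProcess (sleRSObservable κ (1 - (κ : ℝ) / 8) z) (sleTailTime κ z s lam n) ((n : ℝ≥0) + 1) ω ≤
      lam ^ (1 - (κ : ℝ) / 8) * (Ebar.indicator 1 ω + rsGhatSlope (1 - (κ : ℝ) / 8) κ s +
        (sleTailBad κ z s lam n).indicator 1 ω) := by
  have hκ0' : (0 : ℝ) < κ := by exact_mod_cast hκ0
  have hκ8' : (κ : ℝ) ≤ 8 := by exact_mod_cast hκ8
  have ha0 : 0 ≤ 1 - (κ : ℝ) / 8 := by linarith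
  have hW := continuous_sleDriving κ ω
  obtain ⟨u, hu⟩ := WithTop.ne_top_iff_exists.1 (sleTailTime_ne_top (κ := κ) (z := z) (s := s)
    (lam := lam) (n := n) ω)
  have hu' : sleTailTime κ z s lam n ω = u := hu.symm
  have huρ : ((u : ℝ≥0) : WithTop ℝ≥0) ≤ slePointLocTime κ z n ω := hu' ▸ sleTailTime_le_locTime ω
  have hlt : ((u : ℝ≥0) : WithTop ℝ≥0) < swallowingTime (sleDriving κ ω) z :=
    coe_lt_swallowingTime_of_le_locTime hz huρ
  rw [stoppedProcess_critical_succ_eq hz hu']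
  set ψu : ℝ := derivRatio (sleDriving κ ω) z u with hψu
  set G : ℝ := rsGhatSlope (1 - (κ : ℝ) / 8) κ (cotArg (sleDriving κ ω) z u) with hG
  have hψ1 : 1 ≤ ψu := one_le_derivRatio hW hz hlt
  have hψlam : ψu ≤ lam := derivRatio_le_of_sleTailTime_eq hz hlam hu'
  have hGmem : G ∈ Ioc (0 : ℝ) 1 := rsGhatSlope_critical_mem_Ioc hκ0' hκ8' _
  have hGs : 0 < rsGhatSlope (1 - (κ : ℝ) / 8) κ s := (rsGhatSlope_critical_mem_Ioc hκ0' hκ8' s).1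
  have hind1 : 0 ≤ Ebar.indicator (1 : (ℝ≥0 → ℝ) → ℝ) ω := indicator_nonneg (fun _ _ ↦ zero_le_one) ω
  have hind2 : 0 ≤ (sleTailBad κ z s lam n).indicator (1 : (ℝ≥0 → ℝ) → ℝ) ω :=
    indicator_nonneg (fun _ _ ↦ zero_le_one) ω
  -- `ψ_S^{a₀} G ≤ λ^{a₀} G`
  have hpow : ψu ^ (1 - (κ : ℝ) / 8) ≤ lam ^ (1 - (κ : ℝ) / 8) :=
    Real.rpow_le_rpow (by linarith) hψlam ha0
  have hlam0 : 0 ≤ lam ^ (1 - (κ : ℝ) / 8) := Real.rpow_nonneg (by linarith) _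
  have step1 : ψu ^ (1 - (κ : ℝ) / 8) * G ≤ lam ^ (1 - (κ : ℝ) / 8) * G :=
    mul_le_mul_of_nonneg_right hpow hGmem.1.le
  refine step1.trans (mul_le_mul_of_nonneg_left ?_ hlam0)
  -- `G ≤ 𝟙_{Ē} + Ĝ(s) + 𝟙_{Dₙ}`
  by_cases hreach : ω ∈ sleRatioReach κ z lam
  · have : Ebar.indicator (1 : (ℝ≥0 → ℝ) → ℝ) ω = 1 := indicator_of_mem (hE hreach) _
    rw [this]
    linarith [hGmem.2]
  · -- `ψ < λ` before `τ(z)`, so `H_λ = ∞` and `S = T_s ∧ ρₙ`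
    have hall : ∀ t : ℝ≥0, (t : WithTop ℝ≥0) < swallowingTime (sleDriving κ ω) z →
        derivRatio (sleDriving κ ω) z t < lam := by
      intro t ht
      by_contra hge
      exact hreach ⟨t, ht, not_lt.1 hge⟩
    have hH : slePsiHitTime κ z lam n ω = ⊤ := by
      refine slePsiHitTime_eq_top fun t ↦ ?_
      rw [stoppedProcess_slePointPsi_eq]
      exact hall _ (coe_untopA_min_lt_swallowingTime hz (σ := slePointLocTime κ z n) (fun _ ↦ le_rfl) t ω)
    have hS : sleTailTime κ z s lam n ω = sleCotArgLocTime κ z s n ω := by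
      rw [sleTailTime, hH, min_eq_right le_top]
    have h0' : |cotArg (sleDriving κ ω) z 0| < s := by rwa [cotArg_sleDriving_zero κ ω hz]
    by_cases hT : sleCotArgExitTime κ z s ω ≤ slePointLocTime κ z n ω
    · -- `|w|` reaches `s` first: `T_s = S = u`, `|w_u| = s`
      have hTu : cotArgExitTime (sleDriving κ ω) z s = u := by
        have : sleCotArgLocTime κ z s n ω = sleCotArgExitTime κ z s ω := min_eq_left hT
        rw [← sleCotArgExitTime, ← this, ← hS, hu']
      have habs : |cotArg (sleDriving κ ω) z u| = s := abs_cotArg_cotArgExitTime hW hz h0' hTu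
      have hGeq : G = rsGhatSlope (1 - (κ : ℝ) / 8) κ s := by
        rw [hG, ← rsGhatSlope_critical_abs hκ0', habs]
      rw [hGeq]
      linarith
    · -- `ρₙ` rings first: `S = ρₙ = u` and `ω ∈ Dₙ`
      push Not at hT
      have hρu : slePointLocTime κ z n ω = u := by
        have : sleCotArgLocTime κ z s n ω = slePointLocTime κ z n ω := min_eq_right hT.le
        rw [← this, ← hS, hu']
      have hmem : ω ∈ sleTailBad κ z s lam n := by
        refine ⟨?_, fun t ↦ ?_⟩
        · rw [stoppedProcess_slePointPsi_succ, hρu]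
          exact hψlam
        · rw [sleStoppedSlope_eq_cotArg hz]
          set c : ℝ≥0 := (min (t : WithTop ℝ≥0) (slePointLocTime κ z n ω)).untopA with hc
          have hcρ : ((c : ℝ≥0) : WithTop ℝ≥0) ≤ slePointLocTime κ z n ω :=
            coe_untopA_min_le_locTime (σ := slePointLocTime κ z n) (fun _ ↦ le_rfl) t ω
          have hcτ : ((c : ℝ≥0) : WithTop ℝ≥0) < swallowingTime (sleDriving κ ω) z :=
            coe_lt_swallowingTime_of_le_locTime hz hcρ
          have hcT : ((c : ℝ≥0) : WithTop ℝ≥0) < cotArgExitTime (sleDriving κ ω) z s :=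
            hcρ.trans_lt hT
          exact (abs_cotArg_lt_of_lt_cotArgExitTime (sleDriving κ ω) z hcτ hcT).le
      have : (sleTailBad κ z s lam n).indicator (1 : (ℝ≥0 → ℝ) → ℝ) ω = 1 := indicator_of_mem hmem _
      rw [this]
      linarith [hGmem.2, hGs]

end Martingale

/-! ### `Dₙ` is measurable and decreases to `∅` -/

section Bad

/-- For a process with continuous paths, `{∀ t, |f t ω| ≤ s}` is determined by the (dense) times
`(q : ℝ).toNNReal`, `q ∈ ℚ`. [folklore] -/
theorem setOf_forall_abs_le_eq_iInter_rat {Ω : Type*} {f : ℝ≥0 → Ω → ℝ}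
    (hc : ∀ ω, Continuous fun t ↦ f t ω) (s : ℝ) :
    {ω | ∀ t, |f t ω| ≤ s} = ⋂ q : ℚ, {ω | |f ((q : ℝ).toNNReal) ω| ≤ s} := by
  ext ω
  simp only [mem_setOf_eq, mem_iInter]
  refine ⟨fun h q ↦ h _, fun h t ↦ ?_⟩
  have hsurj : Function.Surjective Real.toNNReal := fun x ↦ ⟨x, Real.toNNReal_coe⟩
  have hd : DenseRange (fun q : ℚ ↦ (q : ℝ).toNNReal) :=
    hsurj.denseRange.comp Rat.denseRange_cast continuous_real_toNNReal
  have hclosed : IsClosed {t : ℝ≥0 | |f t ω| ≤ s} :=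
    isClosed_le (continuous_abs.comp (hc ω)) continuous_const
  have hsub : range (fun q : ℚ ↦ (q : ℝ).toNNReal) ⊆ {t : ℝ≥0 | |f t ω| ≤ s} := by
    rintro _ ⟨q, rfl⟩
    exact h q
  have huniv : (univ : Set ℝ≥0) ⊆ {t | |f t ω| ≤ s} := by
    rw [← hd.closure_range]
    exact hclosed.closure_subset_iff.2 hsub
  exact huniv (mem_univ t)

/-- The stopped slope has continuous paths. [folklore] -/
theorem continuous_sleStoppedSlope (hz : 0 < z.im) (n : ℕ) (ω : ℝ≥0 → ℝ) :
    Continuous fun t ↦ sleStoppedSlope κ z n t ω :=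
  (continuous_stoppedProcess_slePointRe hz (σ := slePointLocTime κ z n) (fun _ ↦ le_rfl) ω).div
    (continuous_stoppedProcess_slePointIm hz _ ω) fun t ↦
      (stoppedProcess_slePointIm_pos hz (σ := slePointLocTime κ z n) (fun _ ↦ le_rfl) t ω).ne'

/-- The stopped slope is measurable at each time. [folklore] -/
theorem measurable_sleStoppedSlope (hz : 0 < z.im) (n : ℕ) (t : ℝ≥0) :
    Measurable fun ω ↦ sleStoppedSlope κ z n t ω := by
  have hρ := isStoppingTime_slePointLocTime κ hz n
  exact (((stronglyAdapted_stoppedProcess_slePointRe hz hρ t).mono (brownianFiltration.le _)).measurable).div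
    (((stronglyAdapted_stoppedProcess_slePointIm (κ := κ) hz hρ t).mono (brownianFiltration.le _)).measurable)

/-- **`Dₙ` is an event.** [folklore] -/
theorem measurableSet_sleTailBad (hz : 0 < z.im) (s lam : ℝ) (n : ℕ) :
    MeasurableSet (sleTailBad κ z s lam n) := by
  have hρ := isStoppingTime_slePointLocTime κ hz n
  have h1 : Measurable fun ω ↦
      stoppedProcess (slePointPsi κ z) (slePointLocTime κ z n) ((n : ℝ≥0) + 1) ω :=
    ((stronglyAdapted_stoppedProcess_slePointPsi hz hρ (fun _ ↦ le_rfl) ((n : ℝ≥0) + 1)).mono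
      (brownianFiltration.le _)).measurable
  have hset : sleTailBad κ z s lam n =
      {ω | stoppedProcess (slePointPsi κ z) (slePointLocTime κ z n) ((n : ℝ≥0) + 1) ω ≤ lam} ∩
        {ω | ∀ t, |sleStoppedSlope κ z n t ω| ≤ s} := rfl
  rw [hset, setOf_forall_abs_le_eq_iInter_rat (continuous_sleStoppedSlope hz n)]
  exact (measurableSet_le h1 measurable_const).inter (MeasurableSet.iInter fun q ↦
    measurableSet_le (continuous_abs.measurable.comp (measurable_sleStoppedSlope hz n _))
      measurable_const)

/-- **`Dₙ` is non-increasing in `n`** (`ψ_{ρₙ} ≤ ψ_{ρₙ₊₁}`; the clock values `t ∧ ρₙ` are among the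
`t ∧ ρₙ₊₁`). [folklore] -/
theorem sleTailBad_succ_subset (hz : 0 < z.im) (s lam : ℝ) (n : ℕ) :
    sleTailBad κ z s lam (n + 1) ⊆ sleTailBad κ z s lam n := by
  rintro ω ⟨hψ, hw⟩
  have hW := continuous_sleDriving κ ω
  have hρmono : slePointLocTime κ z n ω ≤ slePointLocTime κ z (n + 1) ω :=
    slePointLocTime_mono hz ω n.le_succ
  refine ⟨?_, fun t ↦ ?_⟩
  · rw [stoppedProcess_slePointPsi_succ] at hψ ⊢
    refine le_trans (derivRatio_mono hW hz ?_ ?_) hψ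
    · rw [← WithTop.coe_le_coe, coe_untopA_slePointLocTime, coe_untopA_slePointLocTime]
      exact hρmono
    · rw [coe_untopA_slePointLocTime]
      exact slePointLocTime_lt_swallowingTime hz (n + 1) ω
  · set c : ℝ≥0 := (min (t : WithTop ℝ≥0) (slePointLocTime κ z n ω)).untopA with hc
    have hcρ : ((c : ℝ≥0) : WithTop ℝ≥0) ≤ slePointLocTime κ z n ω :=
      coe_untopA_min_le_locTime (σ := slePointLocTime κ z n) (fun _ ↦ le_rfl) t ω
    have heq : sleStoppedSlope κ z (n + 1) c ω = sleStoppedSlope κ z n t ω := by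
      rw [sleStoppedSlope_eq_cotArg hz, sleStoppedSlope_eq_cotArg hz, min_eq_left (hcρ.trans hρmono)]
      rfl
    rw [← heq]
    exact hw c

/-- `Dₙ` is antitone. [folklore] -/
theorem antitone_sleTailBad (hz : 0 < z.im) (s lam : ℝ) : Antitone (sleTailBad κ z s lam) :=
  antitone_nat_of_succ_le fun n ↦ sleTailBad_succ_subset hz s lam n

/-- **`⋂ₙ Dₙ = ∅`**: on the intersection `|w| ≤ s` on all of `[0, τ(z))` (every `t < τ(z)` is
`≤ ρₙ` eventually), so `ψₜ → ∞` as `t ↑ τ(z)` (`Loewner.tendsto_derivRatio_atTop_of_abs_cotArg_le`),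
contradicting `ψ_{ρₙ} ≤ λ` for all `n`. [cite: RohdeSchramm2005, Lemma 6.3 (proof)] -/
theorem iInter_sleTailBad_eq_empty (hz : 0 < z.im) (s lam : ℝ) :
    ⋂ n, sleTailBad κ z s lam n = ∅ := by
  refine eq_empty_iff_forall_notMem.2 fun ω hω ↦ ?_
  rw [mem_iInter] at hω
  have hW := continuous_sleDriving κ ω
  have hzW : z ≠ sleDriving κ ω 0 := ne_driving_of_im_pos hz 0
  have hs : ∀ t : ℝ≥0, (t : WithTop ℝ≥0) < swallowingTime (sleDriving κ ω) z →
      |cotArg (sleDriving κ ω) z t| ≤ s := by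
    intro t ht
    obtain ⟨N, hN⟩ := exists_le_slePointLocTime hz ω ht
    have h := (hω N).2 t
    rw [sleStoppedSlope_eq_cotArg hz, min_eq_left (hN N le_rfl)] at h
    exact h
  have hψ := tendsto_derivRatio_atTop_of_abs_cotArg_le hW hz hs
  haveI : Nonempty {t : ℝ≥0 // (t : WithTop ℝ≥0) < swallowingTime (sleDriving κ ω) z} :=
    ⟨⟨0, swallowingTime_pos_holds hW hzW⟩⟩
  obtain ⟨t, ht⟩ := (hψ.eventually_gt_atTop lam).exists
  obtain ⟨N, hN⟩ := exists_le_slePointLocTime hz ω t.2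
  have h1 := (hω N).1
  rw [stoppedProcess_slePointPsi_succ] at h1
  have hmono : derivRatio (sleDriving κ ω) z t ≤
      derivRatio (sleDriving κ ω) z (slePointLocTime κ z N ω).untopA := by
    refine derivRatio_mono hW hz ?_ ?_
    · rw [← WithTop.coe_le_coe, coe_untopA_slePointLocTime]
      exact hN N le_rfl
    · rw [coe_untopA_slePointLocTime]
      exact slePointLocTime_lt_swallowingTime hz N ω
  linarith

/-- `P(Dₙ) → 0`. [folklore] -/
theorem tendsto_measureReal_sleTailBad (hz : 0 < z.im) (s lam : ℝ) :
    Tendsto (fun n ↦ preWienerMeasure.real (sleTailBad κ z s lam n)) atTop (𝓝 0) := by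
  haveI := isProbabilityMeasure_preWienerMeasure'
  have h := tendsto_measure_iInter_atTop (μ := preWienerMeasure) (s := sleTailBad κ z s lam)
    (fun n ↦ (measurableSet_sleTailBad (κ := κ) hz s lam n).nullMeasurableSet)
    (antitone_sleTailBad (κ := κ) hz s lam) ⟨0, measure_ne_top _ _⟩
  rw [iInter_sleTailBad_eq_empty hz, measure_empty] at h
  have h' := (ENNReal.tendsto_toReal ENNReal.zero_ne_top).comp h
  rw [ENNReal.toReal_zero] at h'
  exact h'.congr fun n ↦ rfl

end Bad

/-! ### Integration and the limits `n → ∞`, `s → ∞` -/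

section Tail

/-- **`Ĝ(z) ≤ λ^{a₀} (P(E_λ) + Ĝ(s + i) + P(Dₙ))`** for `|w₀| < s`, `λ ≥ 1`, `0 < κ ≤ 8`: integrate the
pathwise bound `stoppedProcess_critical_succ_le` (with `Ē` the measurable hull of `E_λ`) against the
martingale identity `E[M_{(n+1) ∧ S}] = Ĝ(z)`. [cite: RohdeSchramm2005, Lemma 6.3 (proof)] -/
theorem rsGhatSlope_le_of_lt (hκ0 : 0 < κ) (hκ8 : κ ≤ 8) (hz : 0 < z.im) (h0 : |z.re / z.im| < s)
    (hlam : 1 ≤ lam) (n : ℕ) :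
    rsGhatSlope (1 - (κ : ℝ) / 8) κ (z.re / z.im) ≤ lam ^ (1 - (κ : ℝ) / 8) *
      (preWienerMeasure.real (sleRatioReach κ z lam) + rsGhatSlope (1 - (κ : ℝ) / 8) κ s +
        preWienerMeasure.real (sleTailBad κ z s lam n)) := by
  haveI := isProbabilityMeasure_preWienerMeasure'
  set Ebar : Set (ℝ≥0 → ℝ) := toMeasurable preWienerMeasure (sleRatioReach κ z lam) with hEbar
  have hEm : MeasurableSet Ebar := measurableSet_toMeasurable _ _
  have hEsub : sleRatioReach κ z lam ⊆ Ebar := subset_toMeasurable _ _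
  have hDm := measurableSet_sleTailBad hz s lam n (κ := κ) (z := z)
  have hmart := martingale_stoppedProcess_critical hκ0 hz h0 lam n
  set c : ℝ := lam ^ (1 - (κ : ℝ) / 8) with hc
  set g : ℝ := rsGhatSlope (1 - (κ : ℝ) / 8) κ s with hg
  set F : (ℝ≥0 → ℝ) → ℝ := fun ω ↦ c * (Ebar.indicator 1 ω + g + (sleTailBad κ z s lam n).indicator 1 ω)
    with hF
  have i1 : Integrable (fun ω ↦ Ebar.indicator (1 : (ℝ≥0 → ℝ) → ℝ) ω) preWienerMeasure :=
    (integrable_const 1).indicator hEm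
  have i2 : Integrable (fun _ : ℝ≥0 → ℝ ↦ g) preWienerMeasure := integrable_const g
  have i3 : Integrable (fun ω ↦ (sleTailBad κ z s lam n).indicator (1 : (ℝ≥0 → ℝ) → ℝ) ω)
      preWienerMeasure := (integrable_const 1).indicator hDm
  have hFint : Integrable F preWienerMeasure := ((i1.add i2).add i3).const_mul c
  have hle : ∀ ω, stoppedProcess (sleRSObservable κ (1 - (κ : ℝ) / 8) z) (sleTailTime κ z s lam n)
      ((n : ℝ≥0) + 1) ω ≤ F ω := fun ω ↦
    stoppedProcess_critical_succ_le hκ0 hκ8 hz h0 hlam hEsub ω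
  have hint := integral_mono (hmart.integrable _) hFint hle
  rw [integral_stoppedProcess_critical hκ0 hz h0 lam n] at hint
  have hFval : ∫ ω, F ω ∂preWienerMeasure =
      c * (preWienerMeasure.real (sleRatioReach κ z lam) + g +
        preWienerMeasure.real (sleTailBad κ z s lam n)) := by
    simp only [hF]
    rw [integral_const_mul]
    congr 1
    have e1 : ∫ ω, (Ebar.indicator (1 : (ℝ≥0 → ℝ) → ℝ) ω + g +
        (sleTailBad κ z s lam n).indicator (1 : (ℝ≥0 → ℝ) → ℝ) ω) ∂preWienerMeasure =
        ∫ ω, (Ebar.indicator (1 : (ℝ≥0 → ℝ) → ℝ) ω + g) ∂preWienerMeasure +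
          ∫ ω, (sleTailBad κ z s lam n).indicator (1 : (ℝ≥0 → ℝ) → ℝ) ω ∂preWienerMeasure :=
      integral_add (i1.add i2) i3
    have e2 : ∫ ω, (Ebar.indicator (1 : (ℝ≥0 → ℝ) → ℝ) ω + g) ∂preWienerMeasure =
        ∫ ω, Ebar.indicator (1 : (ℝ≥0 → ℝ) → ℝ) ω ∂preWienerMeasure +
          ∫ _ω, g ∂preWienerMeasure := integral_add i1 i2
    rw [e1, e2, integral_indicator_one hEm, integral_indicator_one hDm, integral_const, smul_eq_mul,
      probReal_univ, one_mul, hEbar, measureReal_def, measure_toMeasurable, ← measureReal_def]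
  rwa [hFval] at hint

/-- **`Ĝ(z) ≤ λ^{a₀} (P(E_λ) + Ĝ(s + i))`** for `|w₀| < s` (`n → ∞` in `rsGhatSlope_le_of_lt`,
`P(Dₙ) → 0`). [cite: RohdeSchramm2005, Lemma 6.3 (proof)] -/
theorem rsGhatSlope_le_of_lt' (hκ0 : 0 < κ) (hκ8 : κ ≤ 8) (hz : 0 < z.im) (h0 : |z.re / z.im| < s)
    (hlam : 1 ≤ lam) :
    rsGhatSlope (1 - (κ : ℝ) / 8) κ (z.re / z.im) ≤ lam ^ (1 - (κ : ℝ) / 8) *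
      (preWienerMeasure.real (sleRatioReach κ z lam) + rsGhatSlope (1 - (κ : ℝ) / 8) κ s) := by
  have hlim := tendsto_measureReal_sleTailBad hz s lam (κ := κ) (z := z)
  have h : Tendsto (fun n ↦ lam ^ (1 - (κ : ℝ) / 8) *
      (preWienerMeasure.real (sleRatioReach κ z lam) + rsGhatSlope (1 - (κ : ℝ) / 8) κ s +
        preWienerMeasure.real (sleTailBad κ z s lam n))) atTop
      (𝓝 (lam ^ (1 - (κ : ℝ) / 8) *
        (preWienerMeasure.real (sleRatioReach κ z lam) + rsGhatSlope (1 - (κ : ℝ) / 8) κ s + 0))) :=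
    (tendsto_const_nhds.add hlim).const_mul _
  rw [add_zero] at h
  exact ge_of_tendsto' h fun n ↦ rsGhatSlope_le_of_lt hκ0 hκ8 hz h0 hlam n

/-- **The lower tail of Rohde–Schramm's ratio** (`0 < κ < 8`, `z ∈ ℍ`, `λ ≥ 1`):
`Ĝ_{1-κ/8,κ}(z) ≤ λ^{1-κ/8} P[∃ t < τ(z), ψₜ(z) ≥ λ]`, i.e.
`P[Z(z) ≥ λ] ≥ (Im z/|z|)^{(8-κ)/κ} λ^{-(1-κ/8)}` — the lower half of the one-point estimate on the
derivative side (Beffara (2008), Prop. 4; Lawler (2005), Thm. 7.9), by optional stopping of the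
critical martingale and `s → ∞` in `rsGhatSlope_le_of_lt'` (`Ĝ(s + i) → 0`).
[cite: Beffara2008, Prop. 4] -/
theorem rsGhatSlope_le_rpow_mul_measureReal (hκ0 : 0 < κ) (hκ8 : κ < 8) (hz : 0 < z.im) {lam : ℝ}
    (hlam : 1 ≤ lam) :
    rsGhatSlope (1 - (κ : ℝ) / 8) κ (z.re / z.im) ≤
      lam ^ (1 - (κ : ℝ) / 8) * preWienerMeasure.real (sleRatioReach κ z lam) := by
  have hκ0' : (0 : ℝ) < κ := by exact_mod_cast hκ0
  have hκ8' : (κ : ℝ) < 8 := by exact_mod_cast hκ8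
  set w₀ : ℝ := z.re / z.im with hw₀
  set sm : ℕ → ℝ := fun m ↦ |w₀| + 1 + m with hsm
  have h0 : ∀ m, |w₀| < sm m := fun m ↦ by
    simp only [hsm]
    have : (0 : ℝ) ≤ m := Nat.cast_nonneg m
    linarith
  have hsm_top : Tendsto sm atTop atTop :=
    tendsto_atTop_add_const_left _ _ tendsto_natCast_atTop_atTop
  have hG : Tendsto (fun m ↦ rsGhatSlope (1 - (κ : ℝ) / 8) κ (sm m)) atTop (𝓝 0) :=
    (tendsto_rsGhatSlope_critical_atTop hκ0' hκ8').comp hsm_top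
  have h : Tendsto (fun m ↦ lam ^ (1 - (κ : ℝ) / 8) *
      (preWienerMeasure.real (sleRatioReach κ z lam) + rsGhatSlope (1 - (κ : ℝ) / 8) κ (sm m))) atTop
      (𝓝 (lam ^ (1 - (κ : ℝ) / 8) * (preWienerMeasure.real (sleRatioReach κ z lam) + 0))) :=
    (tendsto_const_nhds.add hG).const_mul _
  rw [add_zero] at h
  exact ge_of_tendsto' h fun m ↦ rsGhatSlope_le_of_lt' hκ0 hκ8.le hz (h0 m) hlam

end Tail

end Literature.Probability.RandomPlanarGeometry
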